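import Literature.AnabelianGeometry.EtaleTheta.ThetaKummerInversionInnerLiftsNoGo
import Literature.AnabelianGeometry.EtaleTheta.SettingModelChiKummerDataCusp
import HarnessLib

/-!
# The vertex-`0` inner-lift no-go for the FUNCTION-level [EtTh] Prop 1.4 (ii) package at the CUSPED χ-model
# `modelχ′` (proof-only twin of `ThetaKummerInversionInnerLiftsNoGo.lean`)

S. Mochizuki, *The étale theta function …*, Publ. RIMS **45** (2009) [EtTh]: Prop 1.4 (ii) p. 22, §2 p. 36;
*Inter-universal Teichmüller theory II*, Rmk 1.4.1 (ii) p. 28. Classical here. [cite: MochizukiEtTh2009, Prop 1.4 (ii) p.22]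

abc-iut cell, layer L2, seat abc-iut-w5-d125 (gen 8); PROOF-ONLY (NO definition, NO `Prop` fact, NO instance; D-0067). The
cusped χ-twisted root model `ThetaSetting.modelχ′ p` (abc-iut-w5-d029 / abc-iut-L2-t1: `curveχ′` = `curveχ` + one cusp on the
`b`-axis) has the SAME tempered group `Γ ⋊_χ G_{ℚ_p}`, the same `Π^tp_Y`, `Π^tp_Ÿ` (definitionally) and the Kummer core
`kummerCoreχ′` = `kummerCoreχ` field-by-field (abc-iut-w5-d171, `SettingModelChiKummerDataCusp`); several L2 NV certificates
live there. THIS FILE records that the no-go of p469482 holds verbatim at `modelχ′`: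
`not_exists_package_modelχ'_bAxisLift_of_constCompat` (every `z`, every `p`) and
`not_exists_package_modelχ'_innerLift_of_constCompat` (every `γ ∈ Γ` of degree `0`), for `T : ThetaKummerInput (modelχ′ p)`
with `ConstCompat kummerDataχ′`. Same proofs (half-twisted fixed sections over `G_{K_4}`; transport along `Δ^tp_Ÿ`).
HONEST FRAMING: semi-synthetic model, consistency evidence only; nothing disputed is asserted; no side is taken on
[IUTchIII] Cor 3.12; typed ≠ proved.
-/

noncomputable section

namespace Literature.AnabelianGeometry.EtaleTheta.SettingModel

open Literature.AnabelianGeometry.SemiGraphs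
open Literature.AnabelianGeometry.AbsoluteAnabelian

variable (p : ℕ) [Fact p.Prime]

/-- **NO-GO FOR EVERY `b`-AXIS LIFT `Ad(inl b^z) ∘ ι` AT THE CUSPED MODEL `modelχ′`** (all `z ∈ Ẑ`, all `p`; same
group `Γ ⋊_χ G_{ℚ_p}` and same `Π^tp_Ÿ` as `modelχ`, Kummer core `kummerCoreχ′` = `kummerCoreχ` field-by-field): for every
theta-Kummer input `T` over `modelχ′ p` compatible with `kummerDataχ′` and every `ι'` agreeing pointwise with
`Ad(inl b^z) ∘ ι`, there is NO pull-back `ιFn` with `hιFn ∧ hΛ ∧ hιθ` — the half-twisted sections over `G_{K_4}` are an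
`ι'`-fixed subgroup of `Π^tp_Ÿ` with finite-index Galois image (proof verbatim that of
`not_exists_package_modelχ_bAxisLift_of_constCompat`). [cite: MochizukiEtTh2009, Prop 1.4 (ii) p.22] -/
theorem not_exists_package_modelχ'_bAxisLift_of_constCompat (z : ZH) (T : (ThetaSetting.modelχ' p).ThetaKummerInput)
    (hcc : T.ConstCompat (kummerDataχ' p)) (ι' : PiTpχ p ≃ₜ* PiTpχ p)
    (hι' : ∀ x, ι' x = (SemidirectProduct.inl (bPowGfp z) : PiTpχ p) * invχ p x *
      (SemidirectProduct.inl (bPowGfp z))⁻¹) :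
    ¬ ∃ ιFn : T.Fn →* T.Fn,
      (letI := T.instAction; ∀ (g : (ThetaSetting.modelχ' p).PiTemp) (f : T.Fn),
        ιFn (g • f) = (ι' : (ThetaSetting.modelχ' p).PiTemp ≃ₜ* (ThetaSetting.modelχ' p).PiTemp) g • ιFn f) ∧
      (∀ ζ : cyclotome T.Fn, cyclotome.map ιFn ζ = ζ) ∧ ιFn T.theta = T.const (-1) * T.theta := by
  set f : GQp p → ZH := fun σ => half ⟨z / chi p σ z, div_chi_mem_range_sqHom p z σ⟩
  have hf : ∀ σ τ : GQp p, f (σ * τ) = f σ * chi p σ (f τ) := half_div_chi_cocycle p z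
  haveI : FiniteDimensional ℚ_[p] (fieldKN (⊥ : IntermediateField ℚ_[p] (PadicAlgCl p)) (qModel p) 4) :=
    finiteDimensional_fieldKN ⊥ (qModel p) 4
  refine (kummerCoreχ' p).not_exists_package_of_constCompat_of_fixed T hcc ι'
    (H₀ := ((fieldKN (⊥ : IntermediateField ℚ_[p] (PadicAlgCl p)) (qModel p) 4).fixingSubgroup).map
      (sectionχ p f hf)) ?_ ?_ (fieldKN ⊥ (qModel p) 4) ?_
  · -- the half-twisted sections over `G_{K_4}` lie in `Π^tp_Ÿ = Π^tp_{Y_2}`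
    rintro _ ⟨σ, hσ, rfl⟩
    change _ ∈ (ThetaSetting.modelχ p).GtpYdd
    rw [GtpYdd_modelχ]
    refine (sectionχ_mem_YNχ_iff p f hf 2 σ).mpr ⟨level_two_half_div_chi_eq_one p z hσ, ?_⟩
    rw [fieldKN_bot_qModel_two, IntermediateField.fixingSubgroup_bot]
    exact Subgroup.mem_top σ
  · -- they are FIXED by `Ad(b^z) ∘ ι`: `ι` inverts the twist, `Ad(b^z)` multiplies it by `z/χ(σ)z = (f σ)²`
    rintro _ ⟨σ, hσ, rfl⟩
    rw [hι', twistedInversionTop_apply, twistedInversion_sectionχ, conj_inl_bPowGfp_sectionχ]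
    refine sectionχ_congr p _ hf ?_
    have hsq : (f σ) ^ 2 = z / chi p σ z := half_sq ⟨z / chi p σ z, div_chi_mem_range_sqHom p z σ⟩
    rw [← hsq, pow_two, inv_mul_cancel_left]
  · -- Galois image `G_{K_4}`
    ext σ
    constructor
    · rintro ⟨_, ⟨_, ⟨σ', hσ', rfl⟩, rfl⟩, rfl⟩
      rw [(kummerCoreχ' p).augTheta_toTheta]
      exact hσ'
    · intro hσ
      refine ⟨(ThetaSetting.modelχ' p).toTheta (sectionχ p f hf σ), ⟨sectionχ p f hf σ, ⟨σ, hσ, rfl⟩, rfl⟩, ?_⟩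
      rw [(kummerCoreχ' p).augTheta_toTheta]
      rfl


/-- **NO VERTEX-`0` INNER LIFT OF THE INVERSION CARRIES THE FUNCTION-LEVEL PACKAGE AT THE CUSPED MODEL `modelχ′`**:
for every `γ ∈ Γ` of degree `0`, every `ι'` agreeing pointwise with `Ad(inl γ) ∘ ι`, and every `T` over `modelχ′ p` with
injective `Λ(Fn) → Δ_Θ` and `ConstCompat kummerDataχ′`, there is NO `ιFn` with `hιFn ∧ hΛ ∧ hιθ` (transport along
`inl(b^{ŷ γ}·γ⁻¹) ∈ Δ^tp_Ÿ` + the `b`-axis case). [cite: MochizukiEtTh2009, Prop 1.4 (ii) p.22] -/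
theorem not_exists_package_modelχ'_innerLift_of_constCompat (γ : Gfp)
    (hγ : (SemidirectProduct.inl γ : PiTpχ p) ∈ (ThetaSetting.modelχ' p).GtpY)
    (T : (ThetaSetting.modelχ' p).ThetaKummerInput) (hinj : letI := T.instAction; Function.Injective T.coeff.hom)
    (hcc : T.ConstCompat (kummerDataχ' p)) (ι' : PiTpχ p ≃ₜ* PiTpχ p)
    (hι' : ∀ x, ι' x = (SemidirectProduct.inl γ : PiTpχ p) * invχ p x *
      (SemidirectProduct.inl γ)⁻¹) :
    ¬ ∃ ιFn : T.Fn →* T.Fn,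
      (letI := T.instAction; ∀ (g : (ThetaSetting.modelχ' p).PiTemp) (f : T.Fn),
        ιFn (g • f) = (ι' : (ThetaSetting.modelχ' p).PiTemp ≃ₜ* (ThetaSetting.modelχ' p).PiTemp) g • ιFn f) ∧
      (∀ ζ : cyclotome T.Fn, cyclotome.map ιFn ζ = ζ) ∧ ιFn T.theta = T.const (-1) * T.theta := by
  intro hP
  obtain ⟨ιb, hιb⟩ := exists_continuousMulEquiv_bTwist_invχ p (yCoordχ p (SemidirectProduct.inl γ))
  -- `w := inl(b^{ŷ γ}) · (inl γ)⁻¹ ∈ Δ^tp_Ÿ`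
  have hbY : (SemidirectProduct.inl (bPowGfp (yCoordχ p (SemidirectProduct.inl γ))) : PiTpχ p) ∈
      (ThetaSetting.modelχ' p).GtpY :=
    (mem_GtpY_modelχ_iff p _).mpr (by rw [SemidirectProduct.left_inl, gfpSnd_bPowGfp])
  have hwY : (SemidirectProduct.inl (bPowGfp (yCoordχ p (SemidirectProduct.inl γ))) : PiTpχ p) *
      (SemidirectProduct.inl γ)⁻¹ ∈ (ThetaSetting.modelχ' p).GtpY :=
    mul_mem hbY (inv_mem hγ)
  have hyw : yCoordχ p ((SemidirectProduct.inl (bPowGfp (yCoordχ p (SemidirectProduct.inl γ))) : PiTpχ p) *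
      (SemidirectProduct.inl γ)⁻¹) = 1 := by
    rw [yCoordχ_mul, SemidirectProduct.right_inl, map_one, MulAut.one_apply, yCoordχ_inl_bPowGfp, yCoordχ_inl_inv,
      mul_inv_cancel]
  have hwYdd : (SemidirectProduct.inl (bPowGfp (yCoordχ p (SemidirectProduct.inl γ))) : PiTpχ p) *
      (SemidirectProduct.inl γ)⁻¹ ∈ (ThetaSetting.modelχ' p).GtpYdd := by
    by_contra h
    exact level_two_yCoordχ_ne_one_of_not_mem_GtpYdd p hwY h (by rw [hyw, map_one])
  have hwΔ : (ThetaSetting.modelχ' p).aug ((SemidirectProduct.inl (bPowGfp (yCoordχ p (SemidirectProduct.inl γ))) :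
      PiTpχ p) * (SemidirectProduct.inl γ)⁻¹) = 1 := by
    change ((SemidirectProduct.inl (bPowGfp (yCoordχ p (SemidirectProduct.inl γ))) : PiTpχ p) *
      (SemidirectProduct.inl γ)⁻¹).right = 1
    rw [SemidirectProduct.mul_right, SemidirectProduct.inv_right, SemidirectProduct.right_inl,
      SemidirectProduct.right_inl, inv_one, mul_one]
  have hrel : ∀ x, ιb x = (SemidirectProduct.inl (bPowGfp (yCoordχ p (SemidirectProduct.inl γ))) : PiTpχ p) *
      (SemidirectProduct.inl γ)⁻¹ * ι' x *
      ((SemidirectProduct.inl (bPowGfp (yCoordχ p (SemidirectProduct.inl γ))) : PiTpχ p) *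
        (SemidirectProduct.inl γ)⁻¹)⁻¹ := fun x => by
    rw [hιb, hι']
    group
  exact not_exists_package_modelχ'_bAxisLift_of_constCompat p _ T hcc ιb hιb
    (T.exists_package_conj_of_exists_package hinj hwYdd hwΔ ι' ιb hrel hP)


end Literature.AnabelianGeometry.EtaleTheta.SettingModel

end
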